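import Literature.Topology.FourManifolds.OpenCollar
import Literature.Topology.FourManifolds.CollarCriterion
import Mathlib.Analysis.SpecialFunctions.SmoothTransition
import Mathlib.Analysis.Calculus.Deriv.MeanValue
import HarnessLib

/-!
# Shrinking a compact manifold with boundary into its interior along an open collar

Topic `Literature/Topology/FourManifolds` (fact seat
`provefact-Literature.Topology.FourManifolds.exists_cobordismAttachment`: the existence of the
manifold `W ∪_ψ X` obtained by attaching a cobordism `X` to a manifold with boundary `W`,
Milnor, *Lectures on the h-cobordism theorem* (1965), Thm. 1.4, is assembled in
`CobordismAttachmentProofs.lean` as an open gluing of the pieces `W - ∂W` and `X - M`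
(`GluingConstructionBoundary.lean`) along open collars; the copies of `W` and `X` inside the
result are *shrunken* copies, pushed off the glued boundary parts along the collars, and this
file provides that input).  Everything here is proved; no named facts.

Let `M` be a compact Hausdorff `C^∞` manifold with boundary of dimension `n + 1` (model
`𝓡∂ (n + 1)`), `b` a boundary datum, `D : b.OpenCollar` a long open collar
(`OpenCollar.lean`: `toFun : ∂M × [0, ∞) → M` onto the open `region`, inverse `(proj, height)`)
and `K ⊆ ∂M` a clopen set of boundary components to be pushed off.  With a fixed profile
diffeomorphism `σ : ℝ ≅ ℝ`, `σ(t) = t + c` for `t ≤ 0`, `σ(t) = t` for `t ≥ 1` (`c ∈ (0, 1/2]` a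
fixed constant, `CollarShrink.shrinkConst`), the **shrink map** `D.shrink K : M → M` is
`toFun x t ↦ toFun x (σ t)` on the collar region over `K` and the identity elsewhere
(Milnor (1965), proof of Thm. 1.4, and Kosinski, *Differential Manifolds* (1993), VI.5: a
manifold with boundary is diffeomorphic to the complement of an open collar of its boundary).

## Main definitions and results

* `CollarShrink.profile`, `shrinkConst` — the profile `σ` and the constant `c = σ(0)`;
  `contDiff_profile`, `contDiff_profile_symm`.
* `subtypeRestr_mem_maximalAtlas_of_mem`, `contMDiffOn_opens_of_comp_val`,
  `contMDiffOn_opens_opens_of_comp_val`, `isSmoothEmbedding_codRestrict_of_forall_mem` — charts of, and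
  smooth maps / smooth embeddings into, open submanifolds (`TopologicalSpace.Opens`).
* `BoundaryData.OpenCollar.shrink`, `shrink_toFun`, `shrink_incl` (`incl x ↦ toFun x c`),
  `shrink_injective`, `mem_range_shrink_or` (the range is the complement of
  `toFun '' (K × [0, c))`), `contMDiff_shrink`, `isClosedEmbedding_shrink`.
* `BoundaryData.away b K` — the open submanifold `M - incl(K)`; `OpenCollar.shrinkTo` — the
  shrink map corestricted to it.
* `OpenCollar.shrinkHomeo` — off `incl(K)` the shrink map is a partial diffeomorphism
  `M - incl(K) ≅ M - toFun(K × [0, c])`; `isImmersionAt_shrinkTo_of_not_mem`.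
* `OpenCollar.shearChart`, `shearChart_mem_maximalAtlas`, `isImmersionAt_shrinkTo_incl` — at a
  point `incl x₀`, `x₀ ∈ K`, the shrink map reads, in the collar chart `leftChart φ₁` and a
  *sheared* collar chart of `M - incl(K)`, as the linear shear `shearCLE`
  (`v ↦ (v₀ + v₁, v₁, …, vₙ)`); as for collars (`CollarCriterion.lean`, `topChart`) the shear is
  forced by Mathlib's linear normal form of immersions at a corner of the source chart, and needs
  `n ≥ 1`.
* `OpenCollar.isSmoothEmbedding_shrinkTo` — **the corestricted shrink map
  `M → M - incl(K)` is a smooth embedding** (`n ≥ 1`).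

## References

* J. Milnor, *Lectures on the h-cobordism theorem*, Princeton (1965), §1, proof of Thm. 1.4.
  [MilnorHCobordism1965]
* A. Kosinski, *Differential Manifolds*, Academic Press (1993), Ch. VI §5. [Kosinski1993]
-/

open scoped Manifold ContDiff Topology
open Set Function

noncomputable section

namespace Literature.Topology.FourManifolds

universe u

/-- Local notation: `𝔼 n` is the model Euclidean space `EuclideanSpace ℝ (Fin n)`. -/
local notation "𝔼 " n:arg => EuclideanSpace ℝ (Fin n)
/-- Local notation: `ℍ n` is the model half-space `EuclideanHalfSpace n`. -/
local notation "ℍ " n:arg => EuclideanHalfSpace n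

/-! ### The shrinking profile -/

namespace CollarShrink

/-- The bump `β t = smoothTransition (1 - t)`: equal to `1` for `t ≤ 0`, to `0` for `t ≥ 1`,
smooth, with values in `[0, 1]`. [folklore] -/
def bump (t : ℝ) : ℝ := Real.smoothTransition (1 - t)

/-- `β = 1` on `(-∞, 0]`. [folklore] -/
theorem bump_of_nonpos {t : ℝ} (ht : t ≤ 0) : bump t = 1 :=
  Real.smoothTransition.one_of_one_le (by linarith)

/-- `β = 0` on `[1, ∞)`. [folklore] -/
theorem bump_of_one_le {t : ℝ} (ht : 1 ≤ t) : bump t = 0 :=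
  Real.smoothTransition.zero_of_nonpos (by linarith)

/-- `0 ≤ β`. [folklore] -/
theorem bump_nonneg (t : ℝ) : 0 ≤ bump t := Real.smoothTransition.nonneg _

/-- `β ≤ 1`. [folklore] -/
theorem bump_le_one (t : ℝ) : bump t ≤ 1 := Real.smoothTransition.le_one _

/-- `β` is smooth. [folklore] -/
theorem contDiff_bump : ContDiff ℝ ∞ bump :=
  Real.smoothTransition.contDiff.comp (contDiff_const.sub contDiff_id)

/-- The derivative of `β` is continuous. [folklore] -/
theorem continuous_deriv_bump : Continuous (deriv bump) :=
  contDiff_bump.continuous_deriv (by simp)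

/-- The derivative of `β` vanishes on `(-∞, 0)`. [folklore] -/
theorem deriv_bump_of_neg {t : ℝ} (ht : t < 0) : deriv bump t = 0 := by
  have h : bump =ᶠ[𝓝 t] fun _ => (1 : ℝ) := by
    filter_upwards [Iio_mem_nhds ht] with s hs
    exact bump_of_nonpos (le_of_lt hs)
  rw [h.deriv_eq, deriv_const]

/-- The derivative of `β` vanishes on `(1, ∞)`. [folklore] -/
theorem deriv_bump_of_one_lt {t : ℝ} (ht : 1 < t) : deriv bump t = 0 := by
  have h : bump =ᶠ[𝓝 t] fun _ => (0 : ℝ) := by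
    filter_upwards [Ioi_mem_nhds ht] with s hs
    exact bump_of_one_le (le_of_lt hs)
  rw [h.deriv_eq, deriv_const]

/-- A positive bound for the derivative of `β`. [folklore] -/
theorem exists_bound_deriv_bump : ∃ B : ℝ, 0 < B ∧ ∀ t, |deriv bump t| ≤ B := by
  obtain ⟨B, hB⟩ := isCompact_Icc.exists_bound_of_continuousOn
    (s := Icc (0 : ℝ) 1) continuous_deriv_bump.continuousOn
  refine ⟨max B 1, lt_max_of_lt_right one_pos, fun t => ?_⟩
  rcases lt_or_ge t 0 with ht | ht
  · rw [deriv_bump_of_neg ht, abs_zero]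
    exact le_trans zero_le_one (le_max_right _ _)
  rcases le_or_gt t 1 with ht' | ht'
  · exact le_trans (by simpa [Real.norm_eq_abs] using hB t ⟨ht, ht'⟩) (le_max_left _ _)
  · rw [deriv_bump_of_one_lt ht', abs_zero]
    exact le_trans zero_le_one (le_max_right _ _)

/-- **The shrinking constant** `c ∈ (0, 1/2]`: small enough that `t ↦ t + c β(t)` is
increasing. [folklore] -/
def shrinkConst : ℝ := 1 / (2 * Classical.choose exists_bound_deriv_bump + 2)

/-- The chosen bound `B` of `|β'|`. [folklore] -/
theorem bound_spec : 0 < Classical.choose exists_bound_deriv_bump ∧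
    ∀ t, |deriv bump t| ≤ Classical.choose exists_bound_deriv_bump :=
  Classical.choose_spec exists_bound_deriv_bump

/-- `0 < c`. [folklore] -/
theorem shrinkConst_pos : 0 < shrinkConst := by
  have h := bound_spec.1
  unfold shrinkConst
  positivity

/-- `c ≤ 1/2`. [folklore] -/
theorem shrinkConst_le_half : shrinkConst ≤ 1 / 2 := by
  have h := bound_spec.1
  unfold shrinkConst
  exact one_div_le_one_div_of_le (by norm_num) (by linarith)

/-- `c < 1`. [folklore] -/
theorem shrinkConst_lt_one : shrinkConst < 1 := by linarith [shrinkConst_le_half]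

/-- `c |β'| ≤ 1/2`. [folklore] -/
theorem shrinkConst_mul_abs_deriv_le (t : ℝ) : shrinkConst * |deriv bump t| ≤ 1 / 2 := by
  obtain ⟨hB, hBt⟩ := bound_spec
  set B := Classical.choose exists_bound_deriv_bump
  have h1 : shrinkConst * |deriv bump t| ≤ shrinkConst * B :=
    mul_le_mul_of_nonneg_left (hBt t) shrinkConst_pos.le
  refine h1.trans ?_
  unfold shrinkConst
  rw [div_mul_eq_mul_div, one_mul, div_le_iff₀ (by positivity)]
  linarith

/-- **The profile function** `σ(t) = t + c β(t)`: equal to `t + c` for `t ≤ 0`, to `t` for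
`t ≥ 1`, a diffeomorphism of `ℝ`. [folklore] -/
def profileFun (t : ℝ) : ℝ := t + shrinkConst * bump t

/-- `σ(t) = t + c` for `t ≤ 0`. [folklore] -/
theorem profileFun_of_nonpos {t : ℝ} (ht : t ≤ 0) : profileFun t = t + shrinkConst := by
  rw [profileFun, bump_of_nonpos ht, mul_one]

/-- `σ(0) = c`. [folklore] -/
@[simp] theorem profileFun_zero : profileFun 0 = shrinkConst := by
  rw [profileFun_of_nonpos le_rfl, zero_add]

/-- `σ(t) = t` for `t ≥ 1`. [folklore] -/
theorem profileFun_of_one_le {t : ℝ} (ht : 1 ≤ t) : profileFun t = t := by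
  rw [profileFun, bump_of_one_le ht, mul_zero, add_zero]

/-- `t ≤ σ(t)`. [folklore] -/
theorem le_profileFun (t : ℝ) : t ≤ profileFun t :=
  le_add_of_nonneg_right (mul_nonneg shrinkConst_pos.le (bump_nonneg t))

/-- `σ(t) ≤ t + c`. [folklore] -/
theorem profileFun_le (t : ℝ) : profileFun t ≤ t + shrinkConst := by
  have h := mul_le_mul_of_nonneg_left (bump_le_one t) shrinkConst_pos.le
  rw [mul_one] at h
  unfold profileFun
  linarith

/-- `σ` is smooth. [folklore] -/
theorem contDiff_profileFun : ContDiff ℝ ∞ profileFun :=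
  contDiff_id.add (contDiff_const.mul contDiff_bump)

/-- The derivative of `σ`. [folklore] -/
theorem hasDerivAt_profileFun (t : ℝ) :
    HasDerivAt profileFun (1 + shrinkConst * deriv bump t) t := by
  have hb : HasDerivAt bump (deriv bump t) t :=
    (contDiff_bump.differentiable (by simp) t).hasDerivAt
  exact (hasDerivAt_id t).add (hb.const_mul shrinkConst)

/-- The derivative of `σ` is at least `1/2`. [folklore] -/
theorem half_le_deriv_profileFun (t : ℝ) : 1 / 2 ≤ 1 + shrinkConst * deriv bump t := by
  have h := shrinkConst_mul_abs_deriv_le t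
  have h' : -(shrinkConst * |deriv bump t|) ≤ shrinkConst * deriv bump t := by
    rw [← mul_neg]
    exact mul_le_mul_of_nonneg_left (neg_abs_le _) shrinkConst_pos.le
  linarith

/-- The derivative of `σ` is positive. [folklore] -/
theorem deriv_profileFun_pos (t : ℝ) : 0 < 1 + shrinkConst * deriv bump t :=
  lt_of_lt_of_le (by norm_num) (half_le_deriv_profileFun t)

/-- `σ` is strictly increasing. [folklore] -/
theorem strictMono_profileFun : StrictMono profileFun :=
  strictMono_of_hasDerivAt_pos hasDerivAt_profileFun deriv_profileFun_pos

/-- `σ` is continuous. [folklore] -/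
theorem continuous_profileFun : Continuous profileFun := contDiff_profileFun.continuous

/-- `σ` is surjective. [folklore] -/
theorem surjective_profileFun : Surjective profileFun := by
  refine continuous_profileFun.surjective ?_ ?_
  · exact Filter.tendsto_atTop_mono le_profileFun Filter.tendsto_id
  · refine Filter.tendsto_atBot_mono profileFun_le ?_
    exact Filter.tendsto_atBot_add_const_right _ _ Filter.tendsto_id

/-- **The profile** `σ : ℝ ≃ₜ ℝ`. [folklore] -/
def profile : ℝ ≃ₜ ℝ :=
  (strictMono_profileFun.orderIsoOfSurjective profileFun surjective_profileFun).toHomeomorph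

/-- `σ` as a function (definitional). [folklore] -/
@[simp] theorem profile_apply (t : ℝ) : profile t = profileFun t := rfl

/-- `σ` is smooth. [folklore] -/
theorem contDiff_profile : ContDiff ℝ ∞ (profile : ℝ → ℝ) := contDiff_profileFun

/-- `σ⁻¹` is smooth (the derivative of `σ` never vanishes). [folklore] -/
theorem contDiff_profile_symm : ContDiff ℝ ∞ (profile.symm : ℝ → ℝ) :=
  profile.contDiff_symm_deriv (fun t => (deriv_profileFun_pos t).ne') hasDerivAt_profileFun
    contDiff_profile

/-- `σ` is monotone (as a homeomorphism). [folklore] -/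
theorem profile_le_profile_iff {s t : ℝ} : profile s ≤ profile t ↔ s ≤ t :=
  strictMono_profileFun.le_iff_le

/-- `σ` is strictly monotone (as a homeomorphism). [folklore] -/
theorem profile_lt_profile_iff {s t : ℝ} : profile s < profile t ↔ s < t :=
  strictMono_profileFun.lt_iff_lt

/-- `σ(0) = c`. [folklore] -/
@[simp] theorem profile_zero : profile 0 = shrinkConst := profileFun_zero

/-- `σ⁻¹(c) = 0`. [folklore] -/
@[simp] theorem profile_symm_shrinkConst : profile.symm shrinkConst = 0 := by
  rw [Homeomorph.symm_apply_eq, profile_zero]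

/-- `σ(t) = t` for `t ≥ 1`. [folklore] -/
theorem profile_of_one_le {t : ℝ} (ht : 1 ≤ t) : profile t = t := profileFun_of_one_le ht

/-- `σ⁻¹(s) = s` for `s ≥ 1`. [folklore] -/
theorem profile_symm_of_one_le {s : ℝ} (hs : 1 ≤ s) : profile.symm s = s := by
  rw [Homeomorph.symm_apply_eq, profile_of_one_le hs]

/-- `c ≤ σ(t)` for `t ≥ 0`. [folklore] -/
theorem shrinkConst_le_profile {t : ℝ} (ht : 0 ≤ t) : shrinkConst ≤ profile t := by
  rw [← profile_zero, profile_le_profile_iff]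
  exact ht

/-- `c < σ(t)` for `t > 0`. [folklore] -/
theorem shrinkConst_lt_profile {t : ℝ} (ht : 0 < t) : shrinkConst < profile t := by
  rw [← profile_zero, profile_lt_profile_iff]
  exact ht

/-- `0 < σ(t)` for `t ≥ 0`. [folklore] -/
theorem profile_pos {t : ℝ} (ht : 0 ≤ t) : 0 < profile t :=
  lt_of_lt_of_le shrinkConst_pos (shrinkConst_le_profile ht)

/-- `0 ≤ σ⁻¹(s)` iff `c ≤ s`. [folklore] -/
theorem profile_symm_nonneg_iff {s : ℝ} : 0 ≤ profile.symm s ↔ shrinkConst ≤ s := by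
  conv_rhs => rw [← profile.apply_symm_apply s]
  rw [← profile_zero, profile_le_profile_iff]

/-- `0 < σ⁻¹(s)` iff `c < s`. [folklore] -/
theorem profile_symm_pos_iff {s : ℝ} : 0 < profile.symm s ↔ shrinkConst < s := by
  conv_rhs => rw [← profile.apply_symm_apply s]
  rw [← profile_zero, profile_lt_profile_iff]

/-- `σ⁻¹(s) ≤ s`. [folklore] -/
theorem profile_symm_le (s : ℝ) : profile.symm s ≤ s := by
  conv_rhs => rw [← profile.apply_symm_apply s]
  exact le_profileFun _

/-- `σ` is smooth as a map of the manifold `ℝ`. [folklore] -/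
theorem contMDiff_profile : ContMDiff 𝓘(ℝ, ℝ) 𝓘(ℝ, ℝ) ∞ (profile : ℝ → ℝ) :=
  contDiff_profile.contMDiff

/-- `σ⁻¹` is smooth as a map of the manifold `ℝ`. [folklore] -/
theorem contMDiff_profile_symm : ContMDiff 𝓘(ℝ, ℝ) 𝓘(ℝ, ℝ) ∞ (profile.symm : ℝ → ℝ) :=
  contDiff_profile_symm.contMDiff

end CollarShrink

/-! ### Charts and smooth embeddings into open submanifolds -/

section OpensLemmas

variable {E H : Type*} [NormedAddCommGroup E] [NormedSpace ℝ E] [TopologicalSpace H]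
  {I : ModelWithCorners ℝ E H} {M : Type*} [TopologicalSpace M] [ChartedSpace H M]

/-- **Restricting a maximal-atlas chart to an open subset gives a maximal-atlas chart of the
open submanifold** (Mathlib's `StructureGroupoid.subtypeRestr_mem_maximalAtlas` is the case of a
chart of the atlas). [folklore] -/
theorem subtypeRestr_mem_maximalAtlas_of_mem [IsManifold I ∞ M] {e : OpenPartialHomeomorph M H}
    (he : e ∈ IsManifold.maximalAtlas I ∞ M) {U : TopologicalSpace.Opens M} (hU : Nonempty U) :
    e.subtypeRestr hU ∈ IsManifold.maximalAtlas I ∞ U := by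
  rw [IsManifold.mem_maximalAtlas_iff_contMDiffOn]
  constructor
  · intro y hy
    rw [OpenPartialHomeomorph.subtypeRestr_source] at hy
    have h1 : ContMDiffAt I I ∞ e y.val :=
      (contMDiffOn_of_mem_maximalAtlas he).contMDiffAt (e.open_source.mem_nhds hy)
    exact (contMDiffAt_subtype_iff.2 h1).contMDiffWithinAt
  · have h1 : ContMDiffOn I I ∞ e.symm e.target := contMDiffOn_symm_of_mem_maximalAtlas he
    have h2 : ContMDiffOn I I ∞ (Subtype.val ∘ (e.subtypeRestr hU).symm)
        (e.subtypeRestr hU).target :=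
      (h1.mono (e.subtypeRestr_target_subset hU)).congr fun w hw =>
        e.subtypeRestr_symm_apply hU hw
    intro w hw
    exact (ContMDiffWithinAt.subtypeVal_comp_iff U _ _ _).1 (h2 w hw)

/-- A map into an open submanifold is smooth on a set as soon as its composite with the
inclusion agrees there with a map smooth on that set. [folklore] -/
theorem contMDiffOn_opens_of_comp_val {E' H' : Type*} [NormedAddCommGroup E'] [NormedSpace ℝ E']
    [TopologicalSpace H'] {I' : ModelWithCorners ℝ E' H'} {M' : Type*} [TopologicalSpace M']
    [ChartedSpace H' M'] {U : TopologicalSpace.Opens M'} {f : M → U} {F : M → M'} {s : Set M}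
    (hF : ContMDiffOn I I' ∞ F s) (hfF : ∀ x ∈ s, (f x).val = F x) :
    ContMDiffOn I I' ∞ f s := by
  intro x hx
  rw [← ContMDiffWithinAt.subtypeVal_comp_iff]
  exact ((hF x hx).congr (fun y hy => hfF y hy) (hfF x hx))

/-- The same for a map defined on an open submanifold: `f : V → U` is smooth on `s ⊆ V` if
`val ∘ f` agrees on `s` with `F ∘ val` for a map `F` smooth on an open set containing `val '' s`.
[folklore] -/
theorem contMDiffOn_opens_opens_of_comp_val {E' H' : Type*} [NormedAddCommGroup E']
    [NormedSpace ℝ E'] [TopologicalSpace H'] {I' : ModelWithCorners ℝ E' H'} {M' : Type*}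
    [TopologicalSpace M'] [ChartedSpace H' M'] {V : TopologicalSpace.Opens M}
    {U : TopologicalSpace.Opens M'} {f : V → U} {F : M → M'} {s : Set V} {S : Set M}
    (hS : IsOpen S) (hF : ContMDiffOn I I' ∞ F S) (hsS : ∀ x ∈ s, x.val ∈ S)
    (hfF : ∀ x ∈ s, (f x).val = F x.val) : ContMDiffOn I I' ∞ f s := by
  intro x hx
  rw [← ContMDiffWithinAt.subtypeVal_comp_iff]
  have h1 : ContMDiffAt I I' ∞ F x.val := hF.contMDiffAt (hS.mem_nhds (hsS x hx))
  have h2 : ContMDiffAt I I' ∞ (fun y : V => F y.val) x := contMDiffAt_subtype_iff.2 h1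
  exact (h2.contMDiffWithinAt.congr (fun y hy => hfF y hy) (hfF x hx))

/-- **Corestricting a smooth embedding to an open submanifold containing its range gives a
smooth embedding** (the codomain chart is restricted to the open subset). [folklore] -/
theorem isSmoothEmbedding_codRestrict_of_forall_mem {E' H' : Type*} [NormedAddCommGroup E']
    [NormedSpace ℝ E'] [TopologicalSpace H'] {I' : ModelWithCorners ℝ E' H'} {M' : Type*}
    [TopologicalSpace M'] [ChartedSpace H' M'] [IsManifold I' ∞ M'] {f : M → M'}
    (hf : Manifold.IsSmoothEmbedding I I' ∞ f) (U : TopologicalSpace.Opens M') (hU : ∀ x, f x ∈ U) :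
    Manifold.IsSmoothEmbedding I I' ∞ fun x => (⟨f x, hU x⟩ : U) := by
  obtain ⟨⟨F, _, _, hF⟩, hemb⟩ := hf
  refine ⟨Manifold.IsImmersionOfComplement.isImmersion (F := F) fun x => ?_, hemb.codRestrict U hU⟩
  have h := hF x
  have hne : Nonempty U := ⟨⟨f x, hU x⟩⟩
  refine Manifold.IsImmersionAtOfComplement.mk_of_continuousAt
    ((hemb.continuous.subtype_mk hU).continuousAt) h.equiv h.domChart
    (h.codChart.subtypeRestr hne) h.mem_domChart_source ?_ h.domChart_mem_maximalAtlas
    (subtypeRestr_mem_maximalAtlas_of_mem h.codChart_mem_maximalAtlas hne) ?_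
  · rw [OpenPartialHomeomorph.subtypeRestr_source]
    exact h.mem_codChart_source
  · intro u hu
    have hw := h.writtenInCharts hu
    simp only [comp_apply, OpenPartialHomeomorph.extend_coe] at hw ⊢
    rw [OpenPartialHomeomorph.subtypeRestr_coe, restrict_apply]
    exact hw

end OpensLemmas

/-! ### The shrink map of an open collar -/

namespace BoundaryData.OpenCollar

open CollarShrink

variable {n : ℕ} {M : Type u} [TopologicalSpace M] [ChartedSpace (ℍ (n + 1)) M]
  {b : BoundaryData (𝓡∂ (n + 1)) M (𝓡 n)} (D : b.OpenCollar) (K : Set b.carrier)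

/-- The part of the collar region lying over `K ⊆ ∂M`. [folklore] -/
def regionOver : Set M := D.region ∩ D.proj ⁻¹' K

/-- Membership in `regionOver` (definitional). [folklore] -/
theorem mem_regionOver_iff {z : M} : z ∈ D.regionOver K ↔ z ∈ D.region ∧ D.proj z ∈ K := Iff.rfl

/-- Collar points over `K` lie in `regionOver K`. [folklore] -/
theorem toFun_mem_regionOver {x : b.carrier} (hx : x ∈ K) {t : ℝ} (ht : 0 ≤ t) :
    D.toFun x t ∈ D.regionOver K :=
  ⟨D.mem_region x t ht, by rw [mem_preimage, D.proj_apply x t ht]; exact hx⟩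

/-- Boundary points over `K` lie in `regionOver K`. [folklore] -/
theorem incl_mem_regionOver {x : b.carrier} (hx : x ∈ K) : b.incl x ∈ D.regionOver K := by
  rw [← D.apply_zero]
  exact D.toFun_mem_regionOver K hx le_rfl

/-- `regionOver K` is open for `K` open. [folklore] -/
theorem isOpen_regionOver (hK : IsOpen K) : IsOpen (D.regionOver K) :=
  D.continuousOn_proj.isOpen_inter_preimage D.isOpen_region hK

open Classical in
/-- **The shrink map** of the collar over `K`: `toFun x t ↦ toFun x (σ t)` on the collar region
over `K` (so `incl x ↦ toFun x c` for `x ∈ K`, and collar points of height `≥ 1` are fixed), the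
identity elsewhere. This is the self-embedding `M → M - incl(K)` "pushing `M` off the boundary
part `K` along the collar" (Milnor, *Lectures on the h-cobordism theorem* (1965), proof of
Thm. 1.4; Kosinski, *Differential Manifolds* (1993), VI.5). [folklore] -/
def shrink (z : M) : M :=
  if z ∈ D.regionOver K then D.toFun (D.proj z) (profile (D.height z)) else z

/-- The shrink map on the collar region over `K`. [folklore] -/
theorem shrink_of_mem {z : M} (hz : z ∈ D.regionOver K) :
    D.shrink K z = D.toFun (D.proj z) (profile (D.height z)) :=
  if_pos hz

/-- The shrink map off the collar region over `K`. [folklore] -/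
theorem shrink_of_not_mem {z : M} (hz : z ∉ D.regionOver K) : D.shrink K z = z :=
  if_neg hz

/-- The shrink map on collar points over `K`. [folklore] -/
theorem shrink_toFun {x : b.carrier} (hx : x ∈ K) {t : ℝ} (ht : 0 ≤ t) :
    D.shrink K (D.toFun x t) = D.toFun x (profile t) := by
  rw [D.shrink_of_mem K (D.toFun_mem_regionOver K hx ht), D.proj_apply x t ht, D.height_apply x t ht]

/-- The shrink map on boundary points over `K`: `incl x ↦ toFun x c`. [folklore] -/
theorem shrink_incl {x : b.carrier} (hx : x ∈ K) : D.shrink K (b.incl x) = D.toFun x shrinkConst := by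
  rw [← D.apply_zero, D.shrink_toFun K hx le_rfl, profile_zero]

/-- Collar points of height `≥ 1` are fixed. [folklore] -/
theorem shrink_of_one_le_height {z : M} (hz : z ∈ D.region) (h1 : 1 ≤ D.height z) :
    D.shrink K z = z := by
  by_cases h : z ∈ D.regionOver K
  · rw [D.shrink_of_mem K h, profile_of_one_le h1, D.apply_proj_height z hz]
  · exact D.shrink_of_not_mem K h

/-- The shrink map preserves the collar region over `K`. [folklore] -/
theorem shrink_mem_regionOver {z : M} (hz : z ∈ D.regionOver K) : D.shrink K z ∈ D.regionOver K := by
  rw [D.shrink_of_mem K hz]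
  exact D.toFun_mem_regionOver K hz.2 (profile_pos (D.height_nonneg z hz.1)).le

/-- The height of a shrunk collar point. [folklore] -/
theorem height_shrink {z : M} (hz : z ∈ D.regionOver K) :
    D.height (D.shrink K z) = profile (D.height z) := by
  rw [D.shrink_of_mem K hz, D.height_apply _ _ (profile_pos (D.height_nonneg z hz.1)).le]

/-- The projection of a shrunk collar point. [folklore] -/
theorem proj_shrink {z : M} (hz : z ∈ D.regionOver K) : D.proj (D.shrink K z) = D.proj z := by
  rw [D.shrink_of_mem K hz, D.proj_apply _ _ (profile_pos (D.height_nonneg z hz.1)).le]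

/-- Shrunk collar points have height `≥ c`. [folklore] -/
theorem shrinkConst_le_height_shrink {z : M} (hz : z ∈ D.regionOver K) :
    shrinkConst ≤ D.height (D.shrink K z) := by
  rw [D.height_shrink K hz]
  exact shrinkConst_le_profile (D.height_nonneg z hz.1)

/-- Shrunk collar points are interior points. [folklore] -/
theorem isInteriorPoint_shrink {z : M} (hz : z ∈ D.regionOver K) :
    (𝓡∂ (n + 1)).IsInteriorPoint (D.shrink K z) := by
  rw [D.shrink_of_mem K hz]
  exact D.isInteriorPoint_apply _ (profile_pos (D.height_nonneg z hz.1))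

/-- **The shrink map misses `incl(K)`.** [folklore] -/
theorem shrink_ne_incl (z : M) {x : b.carrier} (hx : x ∈ K) : D.shrink K z ≠ b.incl x := by
  intro h
  by_cases hz : z ∈ D.regionOver K
  · have hint := D.isInteriorPoint_shrink K hz
    rw [h, ModelWithCorners.isInteriorPoint_iff_not_isBoundaryPoint] at hint
    exact hint (b.incl_mem_boundary x)
  · rw [D.shrink_of_not_mem K hz] at h
    rw [h] at hz
    exact hz (D.incl_mem_regionOver K hx)

/-- **The shrink map is injective.** [folklore] -/
theorem shrink_injective : Injective (D.shrink K) := by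
  intro z z' h
  by_cases hz : z ∈ D.regionOver K <;> by_cases hz' : z' ∈ D.regionOver K
  · rw [D.shrink_of_mem K hz, D.shrink_of_mem K hz'] at h
    obtain ⟨h1, h2⟩ := D.eq_of_apply_eq (profile_pos (D.height_nonneg z hz.1)).le
      (profile_pos (D.height_nonneg z' hz'.1)).le h
    have h3 : D.height z = D.height z' := profile.injective h2
    rw [← D.apply_proj_height z hz.1, ← D.apply_proj_height z' hz'.1, h1, h3]
  · exfalso
    have hmem := D.shrink_mem_regionOver K hz
    rw [h, D.shrink_of_not_mem K hz'] at hmem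
    exact hz' hmem
  · exfalso
    have hmem := D.shrink_mem_regionOver K hz'
    rw [← h, D.shrink_of_not_mem K hz] at hmem
    exact hz hmem
  · rwa [D.shrink_of_not_mem K hz, D.shrink_of_not_mem K hz'] at h

/-- **The range of the shrink map**: every point is in the range or is a collar point over `K`
of height `< c`. [folklore] -/
theorem mem_range_shrink_or (z : M) :
    z ∈ range (D.shrink K) ∨ ∃ x ∈ K, ∃ t, 0 ≤ t ∧ t < shrinkConst ∧ D.toFun x t = z := by
  by_cases hz : z ∈ D.regionOver K
  · by_cases hc : shrinkConst ≤ D.height z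
    · left
      have ht : 0 ≤ profile.symm (D.height z) := profile_symm_nonneg_iff.2 hc
      refine ⟨D.toFun (D.proj z) (profile.symm (D.height z)), ?_⟩
      rw [D.shrink_toFun K hz.2 ht, profile.apply_symm_apply, D.apply_proj_height z hz.1]
    · right
      exact ⟨D.proj z, hz.2, D.height z, D.height_nonneg z hz.1, lt_of_not_ge hc,
        D.apply_proj_height z hz.1⟩
  · exact Or.inl ⟨z, D.shrink_of_not_mem K hz⟩

/-- Collar points over `K` of height `< c` are not in the range of the shrink map. [folklore] -/
theorem toFun_not_mem_range_shrink {x : b.carrier} (hx : x ∈ K) {t : ℝ} (ht0 : 0 ≤ t)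
    (htc : t < shrinkConst) : D.toFun x t ∉ range (D.shrink K) := by
  rintro ⟨z, hz⟩
  by_cases hzr : z ∈ D.regionOver K
  · rw [D.shrink_of_mem K hzr] at hz
    obtain ⟨-, h2⟩ := D.eq_of_apply_eq (profile_pos (D.height_nonneg z hzr.1)).le ht0 hz
    have h3 := shrinkConst_le_profile (D.height_nonneg z hzr.1)
    rw [h2] at h3
    exact absurd htc (not_lt.2 h3)
  · rw [D.shrink_of_not_mem K hzr] at hz
    rw [hz] at hzr
    exact hzr (D.toFun_mem_regionOver K hx ht0)

/-- A point outside the range of the shrink map lies in the collar region over `K` with height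
`< c`. [folklore] -/
theorem height_lt_of_not_mem_range {z : M} (hz : z ∉ range (D.shrink K)) :
    z ∈ D.regionOver K ∧ D.height z < shrinkConst := by
  obtain h | ⟨x, hx, t, ht0, htc, rfl⟩ := D.mem_range_shrink_or K z
  · exact absurd h hz
  · refine ⟨D.toFun_mem_regionOver K hx ht0, ?_⟩
    rwa [D.height_apply x t ht0]

/-! ### Continuity and smoothness of the shrink map -/

/-- The compact pieces `toFun '' (K × [a, b])` of the collar (`0 ≤ a`, `K` compact). [folklore] -/
theorem isCompact_image_toFun (hKc : IsCompact K) {a c : ℝ} (ha : 0 ≤ a) :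
    IsCompact ((uncurry D.toFun) '' (K ×ˢ Icc a c)) :=
  (hKc.prod isCompact_Icc).image_of_continuousOn
    (D.continuousOn_toFun.mono (prod_mono (subset_univ _) fun _ ht => ha.trans ht.1))

/-- Off `toFun '' (K × [0, 1])` the shrink map is the identity. [folklore] -/
theorem shrink_eq_self_of_not_mem {z : M} (hz : z ∉ (uncurry D.toFun) '' (K ×ˢ Icc 0 1)) :
    D.shrink K z = z := by
  by_cases hzr : z ∈ D.regionOver K
  · refine D.shrink_of_one_le_height K hzr.1 (le_of_not_gt fun h => hz ?_)
    exact ⟨(D.proj z, D.height z), ⟨hzr.2, D.height_nonneg z hzr.1, h.le⟩,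
      D.apply_proj_height z hzr.1⟩
  · exact D.shrink_of_not_mem K hzr

/-- Every point lies in the (open) collar region over `K` or off the (compact) set
`toFun '' (K × [0, 1])`. [folklore] -/
theorem mem_regionOver_or (z : M) :
    z ∈ D.regionOver K ∨ z ∉ (uncurry D.toFun) '' (K ×ˢ Icc 0 1) := by
  by_cases hz : z ∈ D.regionOver K
  · exact Or.inl hz
  · right
    rintro ⟨⟨x, t⟩, ⟨hx, ht⟩, rfl⟩
    exact hz (D.toFun_mem_regionOver K hx ht.1)

/-- On the collar region over `K` the shrink map is smooth (it is
`toFun ∘ (proj, σ ∘ height)`). [folklore] -/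
theorem contMDiffOn_shrink_regionOver :
    ContMDiffOn (𝓡∂ (n + 1)) (𝓡∂ (n + 1)) ∞ (D.shrink K) (D.regionOver K) := by
  have h1 : ContMDiffOn (𝓡∂ (n + 1)) ((𝓡 n).prod 𝓘(ℝ, ℝ)) ∞
      (fun z => (D.proj z, profile (D.height z))) (D.regionOver K) :=
    (D.contMDiffOn_proj.mono inter_subset_left).prodMk
      (contMDiff_profile.comp_contMDiffOn (D.contMDiffOn_height.mono inter_subset_left))
  refine (D.contMDiffOn_toFun.comp h1 ?_).congr ?_
  · intro z hz
    exact ⟨mem_univ _, (profile_pos (D.height_nonneg z hz.1)).le⟩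
  · intro z hz
    exact D.shrink_of_mem K hz

/-- **The shrink map is smooth** (`K` open and compact, i.e. clopen in the compact boundary; `M`
Hausdorff): it is smooth on the open collar region over `K` and the identity on the open
complement of the compact `toFun '' (K × [0, 1])`, and these two open sets cover `M`. [folklore] -/
theorem contMDiff_shrink [T2Space M] (hKo : IsOpen K) (hKc : IsCompact K) :
    ContMDiff (𝓡∂ (n + 1)) (𝓡∂ (n + 1)) ∞ (D.shrink K) := by
  intro z
  rcases D.mem_regionOver_or K z with hz | hz
  · exact (D.contMDiffOn_shrink_regionOver K).contMDiffAt ((D.isOpen_regionOver K hKo).mem_nhds hz)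
  · have hopen : IsOpen ((uncurry D.toFun) '' (K ×ˢ Icc (0 : ℝ) 1))ᶜ :=
      (D.isCompact_image_toFun K hKc le_rfl).isClosed.isOpen_compl
    have heq : D.shrink K =ᶠ[𝓝 z] id := by
      filter_upwards [hopen.mem_nhds hz] with y hy
      exact D.shrink_eq_self_of_not_mem K hy
    exact contMDiffAt_id.congr_of_eventuallyEq heq

/-- The shrink map is continuous. [folklore] -/
theorem continuous_shrink [T2Space M] (hKo : IsOpen K) (hKc : IsCompact K) :
    Continuous (D.shrink K) :=
  (D.contMDiff_shrink K hKo hKc).continuous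

/-- **The shrink map is a closed embedding** (`M` compact Hausdorff). [folklore] -/
theorem isClosedEmbedding_shrink [CompactSpace M] [T2Space M] (hKo : IsOpen K) (hKc : IsCompact K) :
    Topology.IsClosedEmbedding (D.shrink K) :=
  .of_continuous_injective_isClosedMap (D.continuous_shrink K hKo hKc) (D.shrink_injective K)
    (D.continuous_shrink K hKo hKc).isClosedMap

end BoundaryData.OpenCollar

/-! ### The open submanifold `M - incl(K)` and the corestricted shrink map -/

namespace BoundaryData

variable {n : ℕ} {M : Type u} [TopologicalSpace M] [ChartedSpace (ℍ (n + 1)) M]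
  (b : BoundaryData (𝓡∂ (n + 1)) M (𝓡 n)) (K : Set b.carrier)

/-- The open submanifold `M - incl(K)` (defined as the complement of the closure of `incl '' K`,
so that no hypothesis is needed; for `K` compact and `M` Hausdorff this is the complement of
`incl '' K`, `BoundaryData.coe_away`). [folklore] -/
def away : TopologicalSpace.Opens M := ⟨(closure (b.incl '' K))ᶜ, isClosed_closure.isOpen_compl⟩

/-- For `K` compact (`M` Hausdorff), `M - incl(K)` is the complement of `incl '' K`. [folklore] -/
theorem coe_away [T2Space M] (hKc : IsCompact K) : (b.away K : Set M) = (b.incl '' K)ᶜ := by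
  change (closure (b.incl '' K))ᶜ = (b.incl '' K)ᶜ
  rw [(hKc.image b.continuous_incl).isClosed.closure_eq]

/-- Membership in `M - incl(K)`. [folklore] -/
theorem mem_away_iff [T2Space M] (hKc : IsCompact K) {z : M} : z ∈ b.away K ↔ z ∉ b.incl '' K := by
  rw [← SetLike.mem_coe, b.coe_away K hKc, mem_compl_iff]

end BoundaryData

namespace BoundaryData.OpenCollar

open CollarShrink

variable {n : ℕ} {M : Type u} [TopologicalSpace M] [ChartedSpace (ℍ (n + 1)) M]
  {b : BoundaryData (𝓡∂ (n + 1)) M (𝓡 n)} (D : b.OpenCollar) (K : Set b.carrier)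

/-- The shrink map lands in `M - incl(K)`. [folklore] -/
theorem shrink_mem_away [T2Space M] (hKc : IsCompact K) (z : M) : D.shrink K z ∈ b.away K := by
  rw [b.mem_away_iff K hKc]
  rintro ⟨x, hx, h⟩
  exact D.shrink_ne_incl K z hx h.symm

/-- **The shrink map as a map into the open submanifold `M - incl(K)`.** [folklore] -/
def shrinkTo [T2Space M] (hKc : IsCompact K) (z : M) : b.away K :=
  ⟨D.shrink K z, D.shrink_mem_away K hKc z⟩

/-- The underlying point of `shrinkTo` (definitional). [folklore] -/
@[simp] theorem shrinkTo_val [T2Space M] (hKc : IsCompact K) (z : M) :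
    (D.shrinkTo K hKc z).val = D.shrink K z := rfl

/-- `shrinkTo` is injective. [folklore] -/
theorem shrinkTo_injective [T2Space M] (hKc : IsCompact K) : Injective (D.shrinkTo K hKc) :=
  fun _ _ h => D.shrink_injective K (congrArg Subtype.val h)

/-- `shrinkTo` is continuous. [folklore] -/
theorem continuous_shrinkTo [T2Space M] (hKo : IsOpen K) (hKc : IsCompact K) :
    Continuous (D.shrinkTo K hKc) :=
  (D.continuous_shrink K hKo hKc).subtype_mk _

/-- `shrinkTo` is a topological embedding (`M` compact Hausdorff). [folklore] -/
theorem isEmbedding_shrinkTo [CompactSpace M] [T2Space M] (hKo : IsOpen K) (hKc : IsCompact K) :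
    Topology.IsEmbedding (D.shrinkTo K hKc) :=
  (D.isClosedEmbedding_shrink K hKo hKc).isEmbedding.codRestrict (b.away K) (D.shrink_mem_away K hKc)

/-! ### Off `incl(K)` the shrink map is a local diffeomorphism -/

open Classical in
/-- The inverse of the shrink map (meaningful on its range): `toFun x s ↦ toFun x (σ⁻¹ s)` on the
collar region over `K`, the identity elsewhere. [folklore] -/
def unshrink (z : M) : M :=
  if z ∈ D.regionOver K then D.toFun (D.proj z) (profile.symm (D.height z)) else z

/-- The inverse of the shrink map on the collar region over `K`. [folklore] -/
theorem unshrink_of_mem {z : M} (hz : z ∈ D.regionOver K) :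
    D.unshrink K z = D.toFun (D.proj z) (profile.symm (D.height z)) :=
  if_pos hz

/-- The inverse of the shrink map off the collar region over `K`. [folklore] -/
theorem unshrink_of_not_mem {z : M} (hz : z ∉ D.regionOver K) : D.unshrink K z = z :=
  if_neg hz

/-- A point of the collar region over `K` outside `toFun '' (K × [0, c])` has height `> c`.
[folklore] -/
theorem shrinkConst_lt_height {z : M} (hz : z ∈ D.regionOver K)
    (hz' : z ∉ (uncurry D.toFun) '' (K ×ˢ Icc 0 shrinkConst)) : shrinkConst < D.height z := by
  by_contra h
  exact hz' ⟨(D.proj z, D.height z), ⟨hz.2, D.height_nonneg z hz.1, le_of_not_gt h⟩,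
    D.apply_proj_height z hz.1⟩

/-- A point of the collar region over `K` outside `incl '' K` has positive height. [folklore] -/
theorem height_pos_of_not_mem_image {z : M} (hz : z ∈ D.regionOver K) (hz' : z ∉ b.incl '' K) :
    0 < D.height z := by
  rw [D.height_pos_iff hz.1, ← b.range_incl]
  rintro ⟨x, rfl⟩
  refine hz' ⟨x, ?_, rfl⟩
  have h := hz.2
  rwa [mem_preimage, D.proj_incl] at h

/-- `unshrink ∘ shrink = id`. [folklore] -/
theorem unshrink_shrink (z : M) : D.unshrink K (D.shrink K z) = z := by
  by_cases hz : z ∈ D.regionOver K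
  · rw [D.unshrink_of_mem K (D.shrink_mem_regionOver K hz), D.proj_shrink K hz,
      D.height_shrink K hz, profile.symm_apply_apply, D.apply_proj_height z hz.1]
  · rw [D.shrink_of_not_mem K hz, D.unshrink_of_not_mem K hz]

/-- `shrink ∘ unshrink = id` outside `toFun '' (K × [0, c])`. [folklore] -/
theorem shrink_unshrink {z : M} (hz : z ∉ (uncurry D.toFun) '' (K ×ˢ Icc 0 shrinkConst)) :
    D.shrink K (D.unshrink K z) = z := by
  by_cases hzr : z ∈ D.regionOver K
  · have hpos : 0 < profile.symm (D.height z) :=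
      profile_symm_pos_iff.2 (D.shrinkConst_lt_height K hzr hz)
    rw [D.unshrink_of_mem K hzr, D.shrink_toFun K hzr.2 hpos.le, profile.apply_symm_apply,
      D.apply_proj_height z hzr.1]
  · rw [D.unshrink_of_not_mem K hzr, D.shrink_of_not_mem K hzr]

/-- Off `toFun '' (K × [0, 1])` the inverse of the shrink map is the identity. [folklore] -/
theorem unshrink_eq_self_of_not_mem {z : M} (hz : z ∉ (uncurry D.toFun) '' (K ×ˢ Icc 0 1)) :
    D.unshrink K z = z := by
  by_cases hzr : z ∈ D.regionOver K
  · have h1 : 1 ≤ D.height z := by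
      refine le_of_not_gt fun h => hz ?_
      exact ⟨(D.proj z, D.height z), ⟨hzr.2, D.height_nonneg z hzr.1, h.le⟩,
        D.apply_proj_height z hzr.1⟩
    rw [D.unshrink_of_mem K hzr, profile_symm_of_one_le h1, D.apply_proj_height z hzr.1]
  · exact D.unshrink_of_not_mem K hzr

/-- The inverse of the shrink map is smooth outside `toFun '' (K × [0, c])`. [folklore] -/
theorem contMDiffOn_unshrink [T2Space M] (hKo : IsOpen K) (hKc : IsCompact K) :
    ContMDiffOn (𝓡∂ (n + 1)) (𝓡∂ (n + 1)) ∞ (D.unshrink K)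
      ((uncurry D.toFun) '' (K ×ˢ Icc 0 shrinkConst))ᶜ := by
  -- the open piece of the collar region over `K` of height `> c`
  set O : Set M := D.regionOver K ∩ D.height ⁻¹' Ioi shrinkConst with hO
  have hOo : IsOpen O :=
    (D.continuousOn_height.mono inter_subset_left).isOpen_inter_preimage
      (D.isOpen_regionOver K hKo) isOpen_Ioi
  have hsmooth : ContMDiffOn (𝓡∂ (n + 1)) (𝓡∂ (n + 1)) ∞ (D.unshrink K) O := by
    have h1 : ContMDiffOn (𝓡∂ (n + 1)) ((𝓡 n).prod 𝓘(ℝ, ℝ)) ∞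
        (fun z => (D.proj z, profile.symm (D.height z))) O :=
      ((D.contMDiffOn_proj.mono inter_subset_left).prodMk
        (contMDiff_profile_symm.comp_contMDiffOn
          (D.contMDiffOn_height.mono inter_subset_left))).mono inter_subset_left
    refine (D.contMDiffOn_toFun.comp h1 ?_).congr ?_
    · intro z hz
      exact ⟨mem_univ _, (profile_symm_pos_iff.2 hz.2).le⟩
    · intro z hz
      exact D.unshrink_of_mem K hz.1
  have hopen : IsOpen ((uncurry D.toFun) '' (K ×ˢ Icc (0 : ℝ) 1))ᶜ :=
    (D.isCompact_image_toFun K hKc le_rfl).isClosed.isOpen_compl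
  intro z hz
  rcases D.mem_regionOver_or K z with hzr | hzr
  · have hzO : z ∈ O := ⟨hzr, D.shrinkConst_lt_height K hzr hz⟩
    exact (hsmooth.contMDiffAt (hOo.mem_nhds hzO)).contMDiffWithinAt
  · have heq : D.unshrink K =ᶠ[𝓝 z] id := by
      filter_upwards [hopen.mem_nhds hzr] with y hy
      exact D.unshrink_eq_self_of_not_mem K hy
    exact (contMDiffAt_id.congr_of_eventuallyEq heq).contMDiffWithinAt

/-- **The shrink map as a partial diffeomorphism `M - incl(K) ≅ M - toFun(K × [0, c])`.**
[folklore] -/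
def shrinkHomeo [T2Space M] (hKo : IsOpen K) (hKc : IsCompact K) : OpenPartialHomeomorph M M where
  toFun := D.shrink K
  invFun := D.unshrink K
  source := (b.incl '' K)ᶜ
  target := ((uncurry D.toFun) '' (K ×ˢ Icc 0 shrinkConst))ᶜ
  map_source' := by
    intro z hz hmem
    obtain ⟨⟨x, t⟩, ⟨hx, ht0, htc⟩, heq⟩ := hmem
    by_cases hzr : z ∈ D.regionOver K
    · rw [D.shrink_of_mem K hzr] at heq
      obtain ⟨-, h2⟩ := D.eq_of_apply_eq ht0 (profile_pos (D.height_nonneg z hzr.1)).le heq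
      have h3 := shrinkConst_lt_profile (D.height_pos_of_not_mem_image K hzr hz)
      rw [← h2] at h3
      exact absurd htc (not_le.2 h3)
    · rw [D.shrink_of_not_mem K hzr] at heq
      rw [← heq] at hzr
      exact hzr (D.toFun_mem_regionOver K hx ht0)
  map_target' := by
    intro u hu hmem
    obtain ⟨x, hx, hxe⟩ := hmem
    by_cases hur : u ∈ D.regionOver K
    · have hpos : 0 < profile.symm (D.height u) :=
        profile_symm_pos_iff.2 (D.shrinkConst_lt_height K hur hu)
      have hint := D.isInteriorPoint_apply (D.proj u) hpos
      rw [← D.unshrink_of_mem K hur, ← hxe,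
        ModelWithCorners.isInteriorPoint_iff_not_isBoundaryPoint] at hint
      exact hint (b.incl_mem_boundary x)
    · rw [D.unshrink_of_not_mem K hur] at hxe
      rw [← hxe] at hur
      exact hur (D.incl_mem_regionOver K hx)
  left_inv' z _ := D.unshrink_shrink K z
  right_inv' u hu := D.shrink_unshrink K hu
  open_source := (hKc.image b.continuous_incl).isClosed.isOpen_compl
  open_target := (D.isCompact_image_toFun K hKc le_rfl).isClosed.isOpen_compl
  continuousOn_toFun := (D.continuous_shrink K hKo hKc).continuousOn
  continuousOn_invFun := (D.contMDiffOn_unshrink K hKo hKc).continuousOn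

/-- `shrinkHomeo` is the shrink map (definitional). [folklore] -/
@[simp] theorem shrinkHomeo_apply [T2Space M] (hKo : IsOpen K) (hKc : IsCompact K) (z : M) :
    D.shrinkHomeo K hKo hKc z = D.shrink K z := rfl

/-- The inverse of `shrinkHomeo` is `unshrink` (definitional). [folklore] -/
@[simp] theorem shrinkHomeo_symm_apply [T2Space M] (hKo : IsOpen K) (hKc : IsCompact K) (z : M) :
    (D.shrinkHomeo K hKo hKc).symm z = D.unshrink K z := rfl

/-- The source of `shrinkHomeo` (definitional). [folklore] -/
@[simp] theorem shrinkHomeo_source [T2Space M] (hKo : IsOpen K) (hKc : IsCompact K) :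
    (D.shrinkHomeo K hKo hKc).source = (b.incl '' K)ᶜ := rfl

/-- The target of `shrinkHomeo` (definitional). [folklore] -/
@[simp] theorem shrinkHomeo_target [T2Space M] (hKo : IsOpen K) (hKc : IsCompact K) :
    (D.shrinkHomeo K hKo hKc).target = ((uncurry D.toFun) '' (K ×ˢ Icc 0 shrinkConst))ᶜ := rfl

/-- **Off `incl(K)` the corestricted shrink map is an immersion**: in the charts
`shrinkHomeo ≫ χ` of `M` and `χ|_{M - incl(K)}` of the open submanifold, `χ` the chart of `M` at
the image point, it reads as the identity. [folklore] -/
theorem isImmersionAt_shrinkTo_of_not_mem [T2Space M] [IsManifold (𝓡∂ (n + 1)) ∞ M]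
    (hKo : IsOpen K) (hKc : IsCompact K) {z : M} (hz : z ∉ b.incl '' K) :
    Manifold.IsImmersionAtOfComplement PUnit (𝓡∂ (n + 1)) (𝓡∂ (n + 1)) ∞ (D.shrinkTo K hKc) z := by
  set e := D.shrinkHomeo K hKo hKc with he
  set χ : OpenPartialHomeomorph M (ℍ (n + 1)) := chartAt (ℍ (n + 1)) (D.shrink K z) with hχ
  have hχ' : χ ∈ IsManifold.maximalAtlas (𝓡∂ (n + 1)) ∞ M := IsManifold.chart_mem_maximalAtlas _
  have hne : Nonempty (b.away K) := ⟨D.shrinkTo K hKc z⟩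
  have hcod : chartAt (ℍ (n + 1)) (D.shrinkTo K hKc z) = χ.subtypeRestr hne := rfl
  -- the domain chart `e ≫ χ` lies in the maximal atlas
  have hdom : e ≫ₕ χ ∈ IsManifold.maximalAtlas (𝓡∂ (n + 1)) ∞ M := by
    rw [IsManifold.mem_maximalAtlas_iff_contMDiffOn]
    constructor
    · have h1 : ContMDiffOn (𝓡∂ (n + 1)) (𝓡∂ (n + 1)) ∞ (χ ∘ D.shrink K) (e ≫ₕ χ).source :=
        (contMDiffOn_of_mem_maximalAtlas hχ').comp (D.contMDiff_shrink K hKo hKc).contMDiffOn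
          fun y hy => hy.2
      exact h1.congr fun y _ => rfl
    · have h1 : ContMDiffOn (𝓡∂ (n + 1)) (𝓡∂ (n + 1)) ∞ (D.unshrink K ∘ χ.symm) (e ≫ₕ χ).target := by
        refine (D.contMDiffOn_unshrink K hKo hKc).comp
          ((contMDiffOn_symm_of_mem_maximalAtlas hχ').mono ?_) ?_
        · rw [OpenPartialHomeomorph.trans_target]
          exact inter_subset_left
        · intro w hw
          rw [OpenPartialHomeomorph.trans_target] at hw
          exact hw.2
      refine h1.congr fun w _ => ?_
      rfl
  refine Manifold.IsImmersionAtOfComplement.mk_of_continuousAt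
    (D.continuous_shrinkTo K hKo hKc).continuousAt (ContinuousLinearEquiv.prodUnique ℝ _ PUnit)
    (e ≫ₕ χ) (chartAt (ℍ (n + 1)) (D.shrinkTo K hKc z)) ?_ (mem_chart_source _ _) hdom
    (IsManifold.chart_mem_maximalAtlas _) ?_
  · rw [OpenPartialHomeomorph.trans_source]
    exact ⟨hz, mem_chart_source _ _⟩
  · intro w hw
    rw [OpenPartialHomeomorph.extend_target] at hw
    obtain ⟨hw₁, hw₂⟩ := hw
    rw [mem_preimage, OpenPartialHomeomorph.trans_target] at hw₁
    obtain ⟨hwχ, hwe⟩ := hw₁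
    have h1 : ((e ≫ₕ χ).extend (𝓡∂ (n + 1))).symm w = D.unshrink K (χ.symm ((𝓡∂ (n + 1)).symm w)) :=
      rfl
    have h2 : D.shrink K (D.unshrink K (χ.symm ((𝓡∂ (n + 1)).symm w))) = χ.symm ((𝓡∂ (n + 1)).symm w) :=
      D.shrink_unshrink K hwe
    simp only [comp_apply, hcod, OpenPartialHomeomorph.extend_coe, ContinuousLinearEquiv.prodUnique_apply]
    rw [h1, OpenPartialHomeomorph.subtypeRestr_coe, restrict_apply, shrinkTo_val, h2,
      χ.right_inv hwχ, (𝓡∂ (n + 1)).right_inv hw₂]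

/-! ### At `incl(K)`: the sheared collar chart -/

section Shear

/-- The vector `e₀ = (1, 0, …, 0)` of `ℝⁿ`, `n ≥ 1`. [folklore] -/
def unitVec (n : ℕ) [NeZero n] : 𝔼 n := EuclideanSpace.single (0 : Fin n) 1

/-- The coordinate `0` of `e₀` is `1`. [folklore] -/
@[simp] theorem unitVec_apply_zero (n : ℕ) [NeZero n] : unitVec n 0 = 1 := by
  simp [unitVec]

/-- **The shear** `v ↦ (v₀ + v₁, v₁, …, vₙ)` of `ℝⁿ⁺¹ = ℝ × ℝⁿ` (`n ≥ 1`), a linear automorphism: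
in the coordinates `consCLE n (u, t)`, `(u, t) ↦ (u, t + u₀)`. [folklore] -/
def shearCLE (n : ℕ) [NeZero n] : 𝔼 (n + 1) ≃L[ℝ] 𝔼 (n + 1) :=
  (BoundaryManifold.consCLE n).symm.trans
    ((((ContinuousLinearEquiv.refl ℝ (𝔼 n)).skewProd (ContinuousLinearEquiv.refl ℝ ℝ)
      (EuclideanSpace.proj (0 : Fin n))).trans (BoundaryManifold.consCLE n)))

/-- Formula for the shear in the coordinates `(u, t)`. [folklore] -/
@[simp] theorem shearCLE_consCLE (n : ℕ) [NeZero n] (u : 𝔼 n) (t : ℝ) :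
    shearCLE n (BoundaryManifold.consCLE n (u, t)) = BoundaryManifold.consCLE n (u, t + u 0) := by
  simp [shearCLE, ContinuousLinearEquiv.skewProd_apply]

end Shear

section ShearChart

variable [NeZero n] (φ : OpenPartialHomeomorph b.carrier (𝔼 n))

/-- The sheared height `σ⁻¹(height z) + (φ (proj z))₀`. [folklore] -/
def shearFst (z : M) : ℝ := profile.symm (D.height z) + φ (D.proj z) 0

/-- The vector `(max (shearFst z) 0, φ (proj z)) ∈ ℝⁿ⁺¹`. [folklore] -/
def shearVec (z : M) : 𝔼 (n + 1) :=
  BoundaryManifold.consCLE n (φ (D.proj z), max (D.shearFst φ z) 0)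

/-- The source of the sheared chart: collar points over `φ.source` of positive height and
positive sheared height. [folklore] -/
def shearSource : Set M :=
  (D.region ∩ D.proj ⁻¹' φ.source) ∩ (fun z => (D.height z, D.shearFst φ z)) ⁻¹' (Ioi 0 ×ˢ Ioi 0)

/-- The target of the sheared chart, as a subset of `ℝⁿ⁺¹`. [folklore] -/
def shearTargetVec : Set (𝔼 (n + 1)) :=
  {v | BoundaryManifold.tail n v ∈ φ.target} ∩ {v | 0 < v 0} ∩
    {v | 0 < profile (v 0 - BoundaryManifold.tail n v 0)}

/-- Membership in the source of the sheared chart. [folklore] -/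
theorem mem_shearSource_iff {z : M} : z ∈ D.shearSource φ ↔
    (z ∈ D.region ∧ D.proj z ∈ φ.source) ∧ 0 < D.height z ∧ 0 < D.shearFst φ z := by
  simp only [shearSource, mem_inter_iff, mem_preimage, mem_prod, mem_Ioi]

/-- On the source, the coordinate `0` of `shearVec` is the sheared height. [folklore] -/
theorem shearVec_eq_of_mem {z : M} (hz : z ∈ D.shearSource φ) :
    D.shearVec φ z = BoundaryManifold.consCLE n (φ (D.proj z), D.shearFst φ z) := by
  rw [shearVec, max_eq_left ((D.mem_shearSource_iff φ).1 hz).2.2.le]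

/-- `shearVec` has nonnegative coordinate `0`. [folklore] -/
theorem shearVec_apply_zero_nonneg (z : M) : 0 ≤ D.shearVec φ z 0 := by
  rw [shearVec, BoundaryManifold.consCLE_apply_zero]
  exact le_max_right _ _

/-- `shearVec` takes values in the range of `𝓡∂ (n + 1)`. [folklore] -/
theorem shearVec_mem_range (z : M) : D.shearVec φ z ∈ range (𝓡∂ (n + 1)) := by
  rw [range_modelWithCornersEuclideanHalfSpace]
  exact D.shearVec_apply_zero_nonneg φ z

/-- The source of the sheared chart is open. [folklore] -/
theorem isOpen_shearSource : IsOpen (D.shearSource φ) := by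
  have hS₀ : IsOpen (D.region ∩ D.proj ⁻¹' φ.source) := (D.leftChart φ).open_source
  refine ContinuousOn.isOpen_inter_preimage ?_ hS₀ (isOpen_Ioi.prod isOpen_Ioi)
  refine (D.continuousOn_height.mono inter_subset_left).prodMk ?_
  refine (profile.symm.continuous.comp_continuousOn
    (D.continuousOn_height.mono inter_subset_left)).add ?_
  have h1 : ContinuousOn (fun z => φ (D.proj z)) (D.region ∩ D.proj ⁻¹' φ.source) :=
    φ.continuousOn.comp (D.continuousOn_proj.mono inter_subset_left) fun z hz => hz.2
  exact (PiLp.continuous_apply 2 _ (0 : Fin n)).comp_continuousOn h1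

/-- The target of the sheared chart is open in `ℝⁿ⁺¹`. [folklore] -/
theorem isOpen_shearTargetVec : IsOpen (shearTargetVec φ) := by
  refine ((φ.open_target.preimage (BoundaryManifold.continuous_tail n)).inter
    (isOpen_lt continuous_const (PiLp.continuous_apply 2 _ (0 : Fin (n + 1))))).inter ?_
  refine isOpen_lt continuous_const (profile.continuous.comp ?_)
  exact (PiLp.continuous_apply 2 _ (0 : Fin (n + 1))).sub
    ((PiLp.continuous_apply 2 _ (0 : Fin n)).comp (BoundaryManifold.continuous_tail n))

/-- **The sheared collar chart** of `M` over `φ`: `z ↦ (σ⁻¹(height z) + (φ (proj z))₀, φ (proj z))`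
on collar points of positive height and positive sheared height, with inverse
`w ↦ toFun (φ⁻¹ (tail w)) (σ (w₀ - (tail w)₀))`; in it and the collar chart `leftChart φ` the
shrink map reads as the linear shear `shearCLE`. [folklore] -/
def shearChart : OpenPartialHomeomorph M (ℍ (n + 1)) where
  toFun z := ⟨D.shearVec φ z, D.shearVec_apply_zero_nonneg φ z⟩
  invFun w := D.toFun (φ.symm (BoundaryManifold.tail n w.val))
    (profile (w.val 0 - BoundaryManifold.tail n w.val 0))
  source := D.shearSource φ
  target := Subtype.val ⁻¹' shearTargetVec φ
  map_source' := by
    intro z hz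
    obtain ⟨⟨hzr, hzs⟩, hh, hf⟩ := (D.mem_shearSource_iff φ).1 hz
    show D.shearVec φ z ∈ shearTargetVec φ
    rw [D.shearVec_eq_of_mem φ hz]
    refine ⟨⟨?_, ?_⟩, ?_⟩
    · show BoundaryManifold.tail n (BoundaryManifold.consCLE n (φ (D.proj z), D.shearFst φ z)) ∈
        φ.target
      rw [BoundaryManifold.tail_consCLE]
      exact φ.map_source hzs
    · show 0 < BoundaryManifold.consCLE n (φ (D.proj z), D.shearFst φ z) 0
      rwa [BoundaryManifold.consCLE_apply_zero]
    · show 0 < profile (BoundaryManifold.consCLE n (φ (D.proj z), D.shearFst φ z) 0 -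
        BoundaryManifold.tail n (BoundaryManifold.consCLE n (φ (D.proj z), D.shearFst φ z)) 0)
      rw [BoundaryManifold.consCLE_apply_zero, BoundaryManifold.tail_consCLE, shearFst,
        add_sub_cancel_right, profile.apply_symm_apply]
      exact hh
  map_target' := by
    rintro w ⟨⟨hwt, hw0⟩, hwp⟩
    rw [mem_setOf_eq] at hwt hw0 hwp
    set s := profile (w.val 0 - BoundaryManifold.tail n w.val 0) with hs
    rw [D.mem_shearSource_iff φ, D.proj_apply _ _ hwp.le, D.height_apply _ _ hwp.le]
    refine ⟨⟨D.mem_region _ _ hwp.le, φ.map_target hwt⟩, hwp, ?_⟩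
    rw [shearFst, D.proj_apply _ _ hwp.le, D.height_apply _ _ hwp.le, φ.right_inv hwt, hs,
      profile.symm_apply_apply, sub_add_cancel]
    exact hw0
  left_inv' := by
    intro z hz
    obtain ⟨⟨hzr, hzs⟩, hh, hf⟩ := (D.mem_shearSource_iff φ).1 hz
    show D.toFun (φ.symm (BoundaryManifold.tail n (D.shearVec φ z)))
      (profile (D.shearVec φ z 0 - BoundaryManifold.tail n (D.shearVec φ z) 0)) = z
    rw [D.shearVec_eq_of_mem φ hz, BoundaryManifold.tail_consCLE, BoundaryManifold.consCLE_apply_zero,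
      φ.left_inv hzs, shearFst, add_sub_cancel_right, profile.apply_symm_apply]
    exact D.apply_proj_height z hzr
  right_inv' := by
    rintro w ⟨⟨hwt, hw0⟩, hwp⟩
    rw [mem_setOf_eq] at hwt hw0 hwp
    apply Subtype.ext
    show D.shearVec φ _ = w.val
    rw [shearVec, shearFst, D.proj_apply _ _ hwp.le, D.height_apply _ _ hwp.le, φ.right_inv hwt,
      profile.symm_apply_apply, sub_add_cancel, max_eq_left hw0.le]
    exact BoundaryManifold.consCLE_tail n w.val
  open_source := D.isOpen_shearSource φ
  open_target := (isOpen_shearTargetVec φ).preimage continuous_subtype_val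
  continuousOn_toFun := by
    refine Topology.IsInducing.subtypeVal.continuousOn_iff.mpr ?_
    show ContinuousOn (fun z => D.shearVec φ z) (D.shearSource φ)
    refine (BoundaryManifold.consCLE n).continuous.comp_continuousOn ?_
    have hsub : D.shearSource φ ⊆ D.region ∩ D.proj ⁻¹' φ.source := inter_subset_left
    have h1 : ContinuousOn (fun z => φ (D.proj z)) (D.shearSource φ) :=
      φ.continuousOn.comp (D.continuousOn_proj.mono fun z hz => (hsub hz).1) fun z hz => (hsub hz).2
    refine h1.prodMk ((continuous_id.max continuous_const).comp_continuousOn ?_)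
    refine (profile.symm.continuous.comp_continuousOn
      (D.continuousOn_height.mono fun z hz => (hsub hz).1)).add ?_
    exact (PiLp.continuous_apply 2 _ (0 : Fin n)).comp_continuousOn h1
  continuousOn_invFun := by
    have hA : Continuous fun w : ℍ (n + 1) =>
        (BoundaryManifold.tail n w.val, w.val 0 - BoundaryManifold.tail n w.val 0) :=
      ((BoundaryManifold.continuous_tail n).comp continuous_subtype_val).prodMk
        (((PiLp.continuous_apply 2 _ (0 : Fin (n + 1))).comp continuous_subtype_val).sub
          ((PiLp.continuous_apply 2 _ (0 : Fin n)).comp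
            ((BoundaryManifold.continuous_tail n).comp continuous_subtype_val)))
    have hB : ContinuousOn (fun q : 𝔼 n × ℝ => (φ.symm q.1, profile q.2)) (φ.target ×ˢ univ) :=
      (φ.continuousOn_symm.comp continuousOn_fst fun q hq => hq.1).prodMk
        (profile.continuous.comp_continuousOn continuousOn_snd)
    refine D.continuousOn_toFun.comp (hB.comp hA.continuousOn ?_) ?_
    · rintro w ⟨⟨hwt, -⟩, -⟩
      exact ⟨hwt, mem_univ _⟩
    · rintro w ⟨⟨-, -⟩, hwp⟩
      exact ⟨mem_univ _, (le_of_lt hwp : (0 : ℝ) ≤ _)⟩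

/-- The source of the sheared chart (definitional). [folklore] -/
theorem shearChart_source : (D.shearChart φ).source = D.shearSource φ := rfl

/-- The sheared chart as a vector (definitional). [folklore] -/
theorem coe_shearChart (z : M) : (D.shearChart φ z).val = D.shearVec φ z := rfl

/-- The value of the sheared chart on its source. [folklore] -/
theorem coe_shearChart_of_mem {z : M} (hz : z ∈ (D.shearChart φ).source) :
    (D.shearChart φ z).val =
      BoundaryManifold.consCLE n (φ (D.proj z), profile.symm (D.height z) + φ (D.proj z) 0) :=
  D.shearVec_eq_of_mem φ hz

/-- The inverse of the sheared chart (definitional). [folklore] -/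
theorem shearChart_symm_apply (w : ℍ (n + 1)) :
    (D.shearChart φ).symm w = D.toFun (φ.symm (BoundaryManifold.tail n w.val))
      (profile (w.val 0 - BoundaryManifold.tail n w.val 0)) :=
  rfl

/-- The sheared chart is smooth. [folklore] -/
theorem contMDiffOn_shearChart (hφ : φ ∈ IsManifold.maximalAtlas (𝓡 n) ∞ b.carrier) :
    ContMDiffOn (𝓡∂ (n + 1)) (𝓡∂ (n + 1)) ∞ (D.shearChart φ) (D.shearChart φ).source := by
  have hsub : (D.shearChart φ).source ⊆ D.region ∩ D.proj ⁻¹' φ.source := inter_subset_left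
  have hφp : ContMDiffOn (𝓡∂ (n + 1)) 𝓘(ℝ, 𝔼 n) ∞ (fun z => φ (D.proj z)) (D.shearChart φ).source :=
    (contMDiffOn_of_mem_maximalAtlas hφ).comp (D.contMDiffOn_proj.mono fun z hz => (hsub hz).1)
      fun z hz => (hsub hz).2
  have hh : ContMDiffOn (𝓡∂ (n + 1)) 𝓘(ℝ, ℝ) ∞ (fun z => profile.symm (D.height z))
      (D.shearChart φ).source :=
    contMDiff_profile_symm.comp_contMDiffOn (D.contMDiffOn_height.mono fun z hz => (hsub hz).1)
  have hp0 : ContMDiffOn (𝓡∂ (n + 1)) 𝓘(ℝ, ℝ) ∞ (fun z => φ (D.proj z) 0) (D.shearChart φ).source :=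
    (EuclideanSpace.proj (0 : Fin n)).contMDiff.comp_contMDiffOn hφp
  have hF : ContMDiffOn (𝓡∂ (n + 1)) 𝓘(ℝ, ℝ) ∞ (D.shearFst φ) (D.shearChart φ).source :=
    contDiff_add.contMDiff.comp_contMDiffOn (hh.prodMk_space hp0)
  have hG : ContMDiffOn (𝓡∂ (n + 1)) 𝓘(ℝ, 𝔼 (n + 1)) ∞
      (fun z => BoundaryManifold.consCLE n (φ (D.proj z), D.shearFst φ z)) (D.shearChart φ).source :=
    (BoundaryManifold.consCLE n).contDiff.contMDiff.comp_contMDiffOn (hφp.prodMk_space hF)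
  have hG' : ContMDiffOn (𝓡∂ (n + 1)) 𝓘(ℝ, 𝔼 (n + 1)) ∞ (D.shearVec φ) (D.shearChart φ).source :=
    hG.congr fun z hz => D.shearVec_eq_of_mem φ hz
  have hsymm := (𝓡∂ (n + 1)).contMDiffOn_symm (n := ∞)
  have hcomp := hsymm.comp hG' fun z _ => D.shearVec_mem_range φ z
  refine hcomp.congr fun z _ => ?_
  show D.shearChart φ z = (𝓡∂ (n + 1)).symm (D.shearVec φ z)
  apply Subtype.ext
  rw [coe_shearChart]
  obtain ⟨w, hw⟩ := D.shearVec_mem_range φ z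
  rw [← hw, ModelWithCorners.left_inv]
  rfl

/-- The inverse of the sheared chart is smooth. [folklore] -/
theorem contMDiffOn_shearChart_symm (hφ : φ ∈ IsManifold.maximalAtlas (𝓡 n) ∞ b.carrier) :
    ContMDiffOn (𝓡∂ (n + 1)) (𝓡∂ (n + 1)) ∞ (D.shearChart φ).symm (D.shearChart φ).target := by
  have hI := (𝓡∂ (n + 1)).contMDiff (n := ∞)
  have htail : ContMDiff (𝓡∂ (n + 1)) 𝓘(ℝ, 𝔼 n) ∞
      fun w : ℍ (n + 1) => BoundaryManifold.tail n w.val :=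
    (BoundaryManifold.contDiff_tail n).contMDiff.comp hI
  have h1 : ContMDiffOn (𝓡∂ (n + 1)) (𝓡 n) ∞
      (fun w : ℍ (n + 1) => φ.symm (BoundaryManifold.tail n w.val)) (D.shearChart φ).target :=
    (contMDiffOn_symm_of_mem_maximalAtlas hφ).comp htail.contMDiffOn fun w hw => hw.1.1
  have ha : ContMDiff (𝓡∂ (n + 1)) 𝓘(ℝ, ℝ) ∞ fun w : ℍ (n + 1) => w.val 0 :=
    (EuclideanSpace.proj (0 : Fin (n + 1))).contMDiff.comp hI
  have hb : ContMDiff (𝓡∂ (n + 1)) 𝓘(ℝ, ℝ) ∞ fun w : ℍ (n + 1) => BoundaryManifold.tail n w.val 0 :=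
    (EuclideanSpace.proj (0 : Fin n)).contMDiff.comp htail
  have h2 : ContMDiff (𝓡∂ (n + 1)) 𝓘(ℝ, ℝ) ∞
      fun w : ℍ (n + 1) => profile (w.val 0 - BoundaryManifold.tail n w.val 0) :=
    contMDiff_profile.comp ((contDiff_fst.sub contDiff_snd).contMDiff.comp (ha.prodMk_space hb))
  refine (D.contMDiffOn_toFun.comp (h1.prodMk h2.contMDiffOn) ?_).congr fun w _ => rfl
  intro w hw
  exact ⟨mem_univ _, (le_of_lt hw.2 : (0 : ℝ) ≤ _)⟩

/-- The sheared chart belongs to the maximal `C^∞` atlas of `M`. [folklore] -/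
theorem shearChart_mem_maximalAtlas [IsManifold (𝓡∂ (n + 1)) ∞ M]
    (hφ : φ ∈ IsManifold.maximalAtlas (𝓡 n) ∞ b.carrier) :
    D.shearChart φ ∈ IsManifold.maximalAtlas (𝓡∂ (n + 1)) ∞ M :=
  (D.shearChart φ).mem_maximalAtlas_of_contMDiffOn (D.contMDiffOn_shearChart φ hφ)
    (D.contMDiffOn_shearChart_symm φ hφ)

end ShearChart

/-! ### The shrink map is a smooth embedding -/

/-- **At a boundary point `incl x₀`, `x₀ ∈ K`, the corestricted shrink map is an immersion**:
in the collar chart `leftChart φ₁` of `M` (`φ₁` a chart of `∂M` at `x₀` inside `K`, translated so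
that `φ₁ x₀ = e₀`) and the sheared collar chart `shearChart φ₁` restricted to `M - incl(K)`, the
shrink map `toFun x t ↦ toFun x (σ t)` reads as the linear shear `shearCLE`. The translation is what
sends the corner `incl x₀` of the source chart to an interior point of the model half-space under a
*linear* map (the device of `CollarCriterion.lean`, `topChart`); it needs `n ≥ 1`. [folklore] -/
theorem isImmersionAt_shrinkTo_incl [NeZero n] [T2Space M] [IsManifold (𝓡∂ (n + 1)) ∞ M]
    (hKo : IsOpen K) (hKc : IsCompact K) {x₀ : b.carrier} (hx₀ : x₀ ∈ K) :
    Manifold.IsImmersionAtOfComplement PUnit (𝓡∂ (n + 1)) (𝓡∂ (n + 1)) ∞ (D.shrinkTo K hKc)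
      (b.incl x₀) := by
  -- a chart `φ₁` of `∂M` at `x₀`, with source inside `K` and `φ₁ x₀ = e₀`
  set φ₀ : OpenPartialHomeomorph b.carrier (𝔼 n) := chartAt (𝔼 n) x₀ with hφ₀
  set φ₁ : OpenPartialHomeomorph b.carrier (𝔼 n) :=
    (BoundaryData.translChart φ₀ (unitVec n - φ₀ x₀)).restr K with hφ₁def
  have hφ₁ : φ₁ ∈ IsManifold.maximalAtlas (𝓡 n) ∞ b.carrier :=
    restr_mem_maximalAtlas _ (BoundaryData.translChart_mem_maximalAtlas
      (IsManifold.chart_mem_maximalAtlas x₀) _) hKo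
  have hφ₁src : φ₁.source = φ₀.source ∩ K := by
    rw [hφ₁def, OpenPartialHomeomorph.restr_source, hKo.interior_eq]
    rfl
  have hφ₁K : φ₁.source ⊆ K := hφ₁src ▸ inter_subset_right
  have hx₀src : x₀ ∈ φ₁.source := hφ₁src ▸ ⟨mem_chart_source _ x₀, hx₀⟩
  have hφ₁x₀ : φ₁ x₀ = unitVec n := by
    show φ₀ x₀ + (unitVec n - φ₀ x₀) = unitVec n
    abel
  -- the charts
  set C := D.shearChart φ₁ with hC
  have hCatlas : C ∈ IsManifold.maximalAtlas (𝓡∂ (n + 1)) ∞ M := D.shearChart_mem_maximalAtlas φ₁ hφ₁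
  have hne : Nonempty (b.away K) := ⟨D.shrinkTo K hKc (b.incl x₀)⟩
  have hOpen : IsOpen (D.shrink K ⁻¹' C.source) :=
    C.open_source.preimage (D.continuous_shrink K hKo hKc)
  set dom := (D.leftChart φ₁).restr (D.shrink K ⁻¹' C.source) with hdomdef
  have hdom : dom ∈ IsManifold.maximalAtlas (𝓡∂ (n + 1)) ∞ M :=
    restr_mem_maximalAtlas _ (D.leftChart_mem_maximalAtlas φ₁ hφ₁) hOpen
  -- the image point
  have hval : D.shrink K (b.incl x₀) = D.toFun x₀ shrinkConst := D.shrink_incl K hx₀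
  have hmemC : D.toFun x₀ shrinkConst ∈ C.source := by
    rw [hC, shearChart_source, D.mem_shearSource_iff φ₁, D.proj_apply _ _ shrinkConst_pos.le,
      D.height_apply _ _ shrinkConst_pos.le, shearFst, D.proj_apply _ _ shrinkConst_pos.le,
      D.height_apply _ _ shrinkConst_pos.le, profile_symm_shrinkConst, hφ₁x₀, unitVec_apply_zero]
    exact ⟨⟨D.mem_region _ _ shrinkConst_pos.le, hx₀src⟩, shrinkConst_pos, by norm_num⟩
  refine Manifold.IsImmersionAtOfComplement.mk_of_continuousAt
    (D.continuous_shrinkTo K hKo hKc).continuousAt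
    ((ContinuousLinearEquiv.prodUnique ℝ _ PUnit).trans (shearCLE n)) dom (C.subtypeRestr hne)
    ?_ ?_ hdom (subtypeRestr_mem_maximalAtlas_of_mem hCatlas hne) ?_
  · rw [hdomdef, OpenPartialHomeomorph.restr_source, hOpen.interior_eq, leftChart_source]
    refine ⟨⟨D.incl_mem_region x₀, ?_⟩, ?_⟩
    · rw [mem_preimage, D.proj_incl]
      exact hx₀src
    · rw [mem_preimage, hval]
      exact hmemC
  · rw [OpenPartialHomeomorph.subtypeRestr_source, mem_preimage, shrinkTo_val, hval]
    exact hmemC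
  · intro w hw
    rw [OpenPartialHomeomorph.extend_target] at hw
    obtain ⟨hw₁, hw₂⟩ := hw
    have hw0 : 0 ≤ w 0 := by
      rw [range_modelWithCornersEuclideanHalfSpace] at hw₂
      exact hw₂
    have hwval : ((𝓡∂ (n + 1)).symm w).val = w := by
      have h := (𝓡∂ (n + 1)).right_inv hw₂
      exact h
    rw [mem_preimage, hdomdef, OpenPartialHomeomorph.restr_target, hOpen.interior_eq] at hw₁
    obtain ⟨hwt, hwO⟩ := hw₁
    change BoundaryManifold.tail n ((𝓡∂ (n + 1)).symm w).val ∈ φ₁.target at hwt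
    rw [hwval] at hwt
    rw [mem_preimage, mem_preimage, leftChart_symm_apply, hwval] at hwO
    have hxK : φ₁.symm (BoundaryManifold.tail n w) ∈ K := hφ₁K (φ₁.map_target hwt)
    have hsh : D.shrink K (D.toFun (φ₁.symm (BoundaryManifold.tail n w)) (w 0)) =
        D.toFun (φ₁.symm (BoundaryManifold.tail n w)) (profile (w 0)) :=
      D.shrink_toFun K hxK hw0
    rw [hsh] at hwO
    have hCval := D.coe_shearChart_of_mem φ₁ hwO
    rw [D.proj_apply _ _ (profile_pos hw0).le, D.height_apply _ _ (profile_pos hw0).le,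
      profile.symm_apply_apply, φ₁.right_inv hwt] at hCval
    -- compute the written map
    simp only [comp_apply]
    rw [OpenPartialHomeomorph.extend_coe_symm, comp_apply]
    change (C.subtypeRestr hne).extend (𝓡∂ (n + 1))
      (D.shrinkTo K hKc ((D.leftChart φ₁).symm ((𝓡∂ (n + 1)).symm w))) = _
    rw [leftChart_symm_apply, hwval, OpenPartialHomeomorph.extend_coe, comp_apply,
      OpenPartialHomeomorph.subtypeRestr_coe, restrict_apply, shrinkTo_val, hsh]
    change (C (D.toFun (φ₁.symm (BoundaryManifold.tail n w)) (profile (w 0)))).val = _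
    rw [hCval]
    change _ = shearCLE n w
    conv_rhs => rw [← BoundaryManifold.consCLE_tail n w]
    rw [shearCLE_consCLE]

/-- **The corestricted shrink map `M → M - incl(K)` is a smooth embedding** (`M` a compact
Hausdorff `(n+1)`-manifold with boundary, `n ≥ 1`; `K` clopen in `∂M`). [folklore] -/
theorem isSmoothEmbedding_shrinkTo [NeZero n] [CompactSpace M] [T2Space M]
    [IsManifold (𝓡∂ (n + 1)) ∞ M] (hKo : IsOpen K) (hKc : IsCompact K) :
    Manifold.IsSmoothEmbedding (𝓡∂ (n + 1)) (𝓡∂ (n + 1)) ∞ (D.shrinkTo K hKc) := by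
  refine ⟨Manifold.IsImmersionOfComplement.isImmersion (F := Unit) fun z => ?_,
    D.isEmbedding_shrinkTo K hKo hKc⟩
  by_cases hz : z ∈ b.incl '' K
  · obtain ⟨x, hx, rfl⟩ := hz
    exact D.isImmersionAt_shrinkTo_incl K hKo hKc hx
  · exact D.isImmersionAt_shrinkTo_of_not_mem K hKo hKc hz

end BoundaryData.OpenCollar

end Literature.Topology.FourManifolds
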